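import Mathlib
import HarnessLib
import Literature.Analysis.OperatorTheory.SchurComplementCount
import Literature.Analysis.OperatorTheory.SchurComplementPencilBound
import Literature.Analysis.OperatorTheory.SchurComplementResidualBound
import Literature.Analysis.OperatorTheory.PencilRankOneBounds

/-!
# One symmetry block of an exact-diagonalisation pencil certificate, composed

HONEST FRAMING (page 1, pub-hubbard ladder R1–R4 with certified numbers; no claim on H/H₀ — pure matrix
algebra; no certificate exists, nothing here is numerical evidence).

The per-block statement a blocked exact-diagonalisation campaign must certify, in the unnormalised
orbit-sum frame of one symmetry block split into FREE (`m`, high double occupancy) and PINNED (`n`)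
columns: with the real compression `M = fromBlocks M_F M_FP M_FPᵀ M_P`, the diagonal Gram matrix
`G = fromBlocks (diagonal g_F) 0 0 (diagonal g_P)` (`g > 0` = orbit sizes), a level `β`, and constraint
vectors `c_j = Sum.elim (c_{jF}) (c_{jP})` (exact frame coordinates of a certified multiplet) with weights
`t_j ≥ 0`:

  `β · zᵀ G z ≤ zᵀ M z` for every `z` with `c_j ⬝ z = 0` for all `j`.                         (★)

(★) follows from positive semidefiniteness of the rank-`k` modified pencil
`K' = M − β G + Σ_j t_j c_j c_jᵀ = fromBlocks A' B' B'ᵀ D'` (`primedFree/primedCoupling/primedPinned`),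
and `K' ⪰ 0` is delivered by EITHER landed Schur certificate applied with NO deflation vectors:
* `form_ge_of_pencil_chebyshev_block_cert` — corner bound `ρ₀ G_F ⪯ M_F` (`β < ρ₀`; from a Fock-space
  support bound), a Gershgorin-type upper bound `M_F − β G_F ⪯ cmax₀ G_F`, the explicit primed constant
  `cmax' = cmax₀ + Σ_j t_j Σ_a c_{jF,a}²/g_{F,a}` (`PencilRankOneBounds`), and ONE positive-semidefiniteness
  fact for `D' − B'ᵀ p_N(G_F⁻¹A') G_F⁻¹ B'` with the Chebyshev inverse polynomial `p_N`;
* `form_ge_of_residual_block_cert` — corner bound only, any approximate inverse `Y`, ONE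
  positive-semidefiniteness fact for `D' + YᵀA'Y − YᵀB' − B'ᵀY − (ρ₀−β)⁻¹ Rᵀ G_F⁻¹ R`, `R = B' − A'Y`.
References: [Haynsworth1968, Thm 1] (inertia additivity of the Schur complement), [HornJohnson2013,
Thm 7.7.7 / Obs. 7.1.8], [GolubVanLoan2013, §8.7, §11.3].
-/

namespace Literature.Analysis.OperatorTheory

open Matrix Finset Polynomial
open scoped BigOperators

variable {m n : Type*} [Fintype m] [Fintype n] [DecidableEq m] [DecidableEq n]

section Primed

variable {k : ℕ} (MF : Matrix m m ℝ) (MFP : Matrix m n ℝ) (MP : Matrix n n ℝ) (gF : m → ℝ) (gP : n → ℝ)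
  (β : ℝ) (t : Fin k → ℝ) (cF : Fin k → m → ℝ) (cP : Fin k → n → ℝ)

/-- Free block of the rank-modified pencil: `A' = M_F − β G_F + Σ_j t_j c_{jF} c_{jF}ᵀ`.
[cite: Haynsworth1968, Thm 1] -/
def primedFree : Matrix m m ℝ := MF - β • diagonal gF + ∑ j, t j • vecMulVec (cF j) (cF j)

/-- Coupling block: `B' = M_FP + Σ_j t_j c_{jF} c_{jP}ᵀ`. [cite: Haynsworth1968, Thm 1] -/
def primedCoupling : Matrix m n ℝ := MFP + ∑ j, t j • vecMulVec (cF j) (cP j)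

/-- Pinned block: `D' = M_P − β G_P + Σ_j t_j c_{jP} c_{jP}ᵀ`. [cite: Haynsworth1968, Thm 1] -/
def primedPinned : Matrix n n ℝ := MP - β • diagonal gP + ∑ j, t j • vecMulVec (cP j) (cP j)

omit [Fintype m] [Fintype n] [DecidableEq m] [DecidableEq n] in
/-- A dyad of `Sum.elim` vectors is the block matrix of the four dyads. [folklore] -/
private theorem vecMulVec_sumElim (u u' : m → ℝ) (v v' : n → ℝ) :
    vecMulVec (Sum.elim u v) (Sum.elim u' v') =
      fromBlocks (vecMulVec u u') (vecMulVec u v') (vecMulVec v u') (vecMulVec v v') := by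
  ext (i | i) (j | j) <;> rfl

omit [Fintype m] [Fintype n] [DecidableEq m] [DecidableEq n] in
/-- `(u vᵀ)ᵀ = v uᵀ`. [folklore] -/
private theorem vecMulVec_transpose' (u : m → ℝ) (v : n → ℝ) :
    (vecMulVec u v)ᵀ = vecMulVec v u := by
  ext i j
  simp [vecMulVec_apply, mul_comm]

omit [Fintype m] [Fintype n] in
/-- **The rank-modified pencil is the primed block matrix**:
`fromBlocks M_F M_FP M_FPᵀ M_P − β · fromBlocks G_F 0 0 G_P + Σ_j t_j c_j c_jᵀ = fromBlocks A' B' B'ᵀ D'`.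
[cite: Haynsworth1968, Thm 1] -/
theorem rank_modified_pencil_eq_fromBlocks :
    fromBlocks MF MFP MFPᵀ MP - β • fromBlocks (diagonal gF) 0 0 (diagonal gP) +
        ∑ j, t j • vecMulVec (Sum.elim (cF j) (cP j)) (Sum.elim (cF j) (cP j)) =
      fromBlocks (primedFree MF gF β t cF) (primedCoupling MFP t cF cP)
        (primedCoupling MFP t cF cP)ᵀ (primedPinned MP gP β t cP) := by
  have hsum : ∑ j, t j • vecMulVec (Sum.elim (cF j) (cP j)) (Sum.elim (cF j) (cP j)) =
      fromBlocks (∑ j, t j • vecMulVec (cF j) (cF j)) (∑ j, t j • vecMulVec (cF j) (cP j))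
        (∑ j, t j • vecMulVec (cP j) (cF j)) (∑ j, t j • vecMulVec (cP j) (cP j)) := by
    induction (Finset.univ : Finset (Fin k)) using Finset.induction_on with
    | empty => simp
    | insert j s hj ih =>
      rw [Finset.sum_insert hj, Finset.sum_insert hj, Finset.sum_insert hj, Finset.sum_insert hj,
        Finset.sum_insert hj, ih, vecMulVec_sumElim, fromBlocks_smul, fromBlocks_add]
  have hT : (primedCoupling MFP t cF cP)ᵀ = MFPᵀ + ∑ j, t j • vecMulVec (cP j) (cF j) := by
    unfold primedCoupling
    rw [transpose_add, transpose_sum]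
    congr 1
    exact Finset.sum_congr rfl fun j _ => by rw [transpose_smul, vecMulVec_transpose']
  rw [hsum, hT, fromBlocks_smul, smul_zero, smul_zero]
  unfold primedFree primedCoupling primedPinned
  ext (i | i) (j | j) <;> simp [fromBlocks, sub_eq_add_neg, add_assoc]

/-- (★) from global positive semidefiniteness of the primed block matrix (no constraint needed there:
the dyads vanish on `{c_j ⬝ z = 0}`). [cite: Haynsworth1968, Thm 1] -/
theorem form_ge_of_primed_nonneg
    (hpsd : ∀ (x : m → ℝ) (y : n → ℝ), 0 ≤ (Sum.elim x y) ⬝ᵥ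
      (fromBlocks (primedFree MF gF β t cF) (primedCoupling MFP t cF cP)
        (primedCoupling MFP t cF cP)ᵀ (primedPinned MP gP β t cP) *ᵥ Sum.elim x y))
    (z : m ⊕ n → ℝ) (hz : ∀ j, Sum.elim (cF j) (cP j) ⬝ᵥ z = 0) :
    β * (z ⬝ᵥ (fromBlocks (diagonal gF) 0 0 (diagonal gP) *ᵥ z)) ≤
      z ⬝ᵥ (fromBlocks MF MFP MFPᵀ MP *ᵥ z) := by
  have h0 : 0 ≤ z ⬝ᵥ ((fromBlocks MF MFP MFPᵀ MP - β • fromBlocks (diagonal gF) 0 0 (diagonal gP) +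
      ∑ j, t j • vecMulVec (Sum.elim (cF j) (cP j)) (Sum.elim (cF j) (cP j))) *ᵥ z) := by
    rw [rank_modified_pencil_eq_fromBlocks, ← Sum.elim_comp_inl_inr z]
    exact hpsd _ _
  rw [add_mulVec, dotProduct_add, dotProduct_sum_vecMulVec_mulVec_eq_zero t _ z hz, add_zero,
    sub_mulVec, dotProduct_sub, smul_mulVec, dotProduct_smul, smul_eq_mul] at h0
  linarith

end Primed

section Certificates

variable {k : ℕ} (MF : Matrix m m ℝ) (MFP : Matrix m n ℝ) (MP : Matrix n n ℝ) (gF : m → ℝ)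
  (gP : n → ℝ) (β ρ₀ : ℝ) (t : Fin k → ℝ) (cF : Fin k → m → ℝ) (cP : Fin k → n → ℝ)

omit [DecidableEq n] in
/-- The free-block lower pencil bound of `A'` from the corner bound `ρ₀ G_F ⪯ M_F` (`t ≥ 0`):
`(ρ₀ − β) G_F ⪯ A'`. [cite: HornJohnson2013, Thm 7.7.3] -/
theorem primedFree_sub_smul_posSemidef (hMF : MF.IsHermitian) (ht : ∀ j, 0 ≤ t j)
    (hcorner : ∀ x : m → ℝ, ρ₀ * (x ⬝ᵥ (diagonal gF *ᵥ x)) ≤ x ⬝ᵥ (MF *ᵥ x)) :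
    (primedFree MF gF β t cF - (ρ₀ - β) • diagonal gF).PosSemidef := by
  have hGd : (diagonal gF : Matrix m m ℝ).IsHermitian := isHermitian_diagonal gF
  have h1 : (MF - β • diagonal gF - (ρ₀ - β) • diagonal gF).PosSemidef := by
    have e : MF - β • diagonal gF - (ρ₀ - β) • diagonal gF = MF - ρ₀ • diagonal gF := by
      rw [sub_smul]; abel
    rw [e]
    refine Matrix.PosSemidef.of_dotProduct_mulVec_nonneg
      (hMF.sub (hGd.smul (IsSelfAdjoint.all ρ₀))) fun x => ?_
    have hx := hcorner x
    rw [star_trivial, sub_mulVec, dotProduct_sub, smul_mulVec, dotProduct_smul, smul_eq_mul]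
    linarith
  have h2 := posSemidef_add_sum_vecMulVec_sub_smul (MF - β • diagonal gF) (diagonal gF) (ρ₀ - β) h1
    t ht cF
  have e : primedFree MF gF β t cF - (ρ₀ - β) • diagonal gF =
      MF - β • diagonal gF + ∑ j, t j • vecMulVec (cF j) (cF j) - (ρ₀ - β) • diagonal gF := rfl
  rw [e]
  exact h2

omit [DecidableEq n] in
/-- The free-block upper pencil bound of `A'` with the explicit primed constant:
`M_F − β G_F ⪯ cmax₀ G_F`, `g_F > 0`, `t ≥ 0` give `A' ⪯ (cmax₀ + Σ_j t_j Σ_a c_{jF,a}²/g_{F,a}) G_F`.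
[cite: HornJohnson2013, Thm 7.7.3] -/
theorem smul_sub_primedFree_posSemidef (hgF : ∀ a, 0 < gF a) (ht : ∀ j, 0 ≤ t j) (cmax₀ : ℝ)
    (hGersh : (cmax₀ • diagonal gF - (MF - β • diagonal gF)).PosSemidef) :
    ((cmax₀ + ∑ j, t j * ∑ a, cF j a ^ 2 / gF a) • diagonal gF - primedFree MF gF β t cF).PosSemidef :=
  posSemidef_smul_diagonal_sub_add_sum_vecMulVec (MF - β • diagonal gF) gF hgF cmax₀ hGersh t ht cF

/-- **Per-block pencil certificate, Chebyshev shape.** Inputs the verifier checks in exact arithmetic: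
the corner bound (a theorem about the free columns' support), `M_F − βG_F ⪯ cmax₀ G_F` (Gershgorin /
diagonal dominance), `t ≥ 0`, and ONE positive-semidefiniteness fact for
`D' − B'ᵀ p_N(G_F⁻¹ A') G_F⁻¹ B'`; output (★). [cite: Haynsworth1968, Thm 1]
[cite: GolubVanLoan2013, §11.3] -/
theorem form_ge_of_pencil_chebyshev_block_cert (hMF : MF.IsHermitian) (hgF : ∀ a, 0 < gF a)
    (hβ : β < ρ₀) (ht : ∀ j, 0 ≤ t j)
    (hcorner : ∀ x : m → ℝ, ρ₀ * (x ⬝ᵥ (diagonal gF *ᵥ x)) ≤ x ⬝ᵥ (MF *ᵥ x)) (cmax₀ : ℝ)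
    (hGersh : (cmax₀ • diagonal gF - (MF - β • diagonal gF)).PosSemidef) {N : ℕ} (hN : N ≠ 0)
    (hcm : ρ₀ - β < cmax₀ + ∑ j, t j * ∑ a, cF j a ^ 2 / gF a)
    (hcert : (primedPinned MP gP β t cP - (primedCoupling MFP t cF cP)ᵀ *
        (aeval (diagonal (fun i => (gF i)⁻¹) * primedFree MF gF β t cF)
          (Literature.Analysis.ValidatedNumerics.chebInvPoly (ρ₀ - β)
            (cmax₀ + ∑ j, t j * ∑ a, cF j a ^ 2 / gF a) N) *
          diagonal (fun i => (gF i)⁻¹)) * primedCoupling MFP t cF cP).PosSemidef)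
    (z : m ⊕ n → ℝ) (hz : ∀ j, Sum.elim (cF j) (cP j) ⬝ᵥ z = 0) :
    β * (z ⬝ᵥ (fromBlocks (diagonal gF) 0 0 (diagonal gP) *ᵥ z)) ≤
      z ⬝ᵥ (fromBlocks MF MFP MFPᵀ MP *ᵥ z) := by
  refine form_ge_of_primed_nonneg MF MFP MP gF gP β t cF cP (fun x y => ?_) z hz
  refine fromBlocks_dotProduct_nonneg_of_pencil_chebyshev_cert (k := 0) _ _ _ gF ![] ![] hgF
    (sub_pos.mpr hβ) hcm hN (primedFree_sub_smul_posSemidef MF gF β ρ₀ t cF hMF ht hcorner)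
    (smul_sub_primedFree_posSemidef MF gF β t cF hgF ht cmax₀ hGersh) ?_ x y (fun j => Fin.elim0 j)
  simpa using hcert

/-- **Per-block pencil certificate, residual (approximate-inverse) shape.** Inputs: the corner bound,
`t ≥ 0`, any matrix `Y`, and ONE positive-semidefiniteness fact for
`D' + YᵀA'Y − YᵀB' − B'ᵀY − (ρ₀−β)⁻¹ (B' − A'Y)ᵀ G_F⁻¹ (B' − A'Y)`; output (★).
[cite: Haynsworth1968, Thm 1] [cite: HornJohnson2013, Thm 7.7.7] -/
theorem form_ge_of_residual_block_cert (hMF : MF.IsHermitian) (hgF : ∀ a, 0 < gF a) (hβ : β < ρ₀)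
    (ht : ∀ j, 0 ≤ t j)
    (hcorner : ∀ x : m → ℝ, ρ₀ * (x ⬝ᵥ (diagonal gF *ᵥ x)) ≤ x ⬝ᵥ (MF *ᵥ x)) (Y : Matrix m n ℝ)
    (hcert : (primedPinned MP gP β t cP + Yᵀ * primedFree MF gF β t cF * Y -
        Yᵀ * primedCoupling MFP t cF cP - (primedCoupling MFP t cF cP)ᵀ * Y -
        (ρ₀ - β)⁻¹ • ((primedCoupling MFP t cF cP - primedFree MF gF β t cF * Y)ᵀ *
          diagonal (fun i => (gF i)⁻¹) *
          (primedCoupling MFP t cF cP - primedFree MF gF β t cF * Y))).PosSemidef)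
    (z : m ⊕ n → ℝ) (hz : ∀ j, Sum.elim (cF j) (cP j) ⬝ᵥ z = 0) :
    β * (z ⬝ᵥ (fromBlocks (diagonal gF) 0 0 (diagonal gP) *ᵥ z)) ≤
      z ⬝ᵥ (fromBlocks MF MFP MFPᵀ MP *ᵥ z) := by
  have hA : (primedFree MF gF β t cF)ᵀ = primedFree MF gF β t cF := by
    have h := (primedFree_sub_smul_posSemidef MF gF β ρ₀ t cF hMF ht hcorner).isHermitian
    have hGd : (diagonal gF : Matrix m m ℝ).IsHermitian := isHermitian_diagonal gF
    have h' := h.add (hGd.smul (IsSelfAdjoint.all (ρ₀ - β)))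
    rw [sub_add_cancel] at h'
    simpa using h'.eq
  refine form_ge_of_primed_nonneg MF MFP MP gF gP β t cF cP (fun x y => ?_) z hz
  refine fromBlocks_dotProduct_nonneg_of_residual_cert (k := 0) _ _ _ gF (ρ₀ - β) Y ![] ![] hgF
    (sub_pos.mpr hβ) hA (primedFree_sub_smul_posSemidef MF gF β ρ₀ t cF hMF ht hcorner) ?_ x y
    (fun j => Fin.elim0 j)
  simpa using hcert

end Certificates

end Literature.Analysis.OperatorTheory
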